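import Mathlib

/-!
# `MomentsToParity` (item stmt-Parity-11620, route IsogenyRedei): the model moments are parity-blind

Item stmt-Parity-11620 (support `MomentsToParity`; informal, never typed) rests on the sentence
"a moment-DETERMINACY step for parity-mixtures `p·L₀ + (1−p)·L₁` of the two model laws (corank laws
of the Rédei-type matrices with prescribed size parity, à la Poonen–Rains / Heath-Brown 1994-II),
WHICH HAVE DISTINCT MOMENT SEQUENCES, so the moments fix the mixing weight `p = 1/2`".
This file proves, sorry-free and without new definitions, that the capitalised clause is FALSE.

Write `a_r := 2^r / ∏_{j=1}^{r} (2^j − 1)` for Heath-Brown's unnormalised Selmer-rank weights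
(`d_r = λ·a_r`, Heath-Brown 1994-II Thm 2; the `p = 2` Poonen–Rains law).  Any `a : ℕ → ℝ` with the
recursion `a_{r+1}·(2^{r+1} − 1) = 2·a_r` has an entire generating function `G(x) = Σ_r a_r x^r` with
EULER'S FUNCTIONAL EQUATION `G(2x) = (1 + 2x)·G(x)` (`tsum_two_mul`); hence `G(−1) = 0·G(−1/2) = 0`
and inductively `G(−2^{k+1}) = (1 − 2^{k+1})·G(−2^k) = 0`, i.e. `Σ_r (−1)^r 2^{k r} a_r = 0` for ALL
`k : ℕ` (`hasSum_alternatingMoment`; equivalently Euler's product `∏_{m≥0}(1 − z/2^m) = Σ_r (−z)^r a_r`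
vanishes at `z = 2^k`).  So `Σ_{r even} 2^{k r} a_r = Σ_{r odd} 2^{k r} a_r`
(`exists_hasSum_evenMoment_and_oddMoment`), the common value being `(∏_{j=1}^{k}(1 + 2^j))·M_0`
(`hasSum_evenMoment_eq_prod_mul`): normalised, `c_k = 1, 3, 15, 135, 2295, …`, Heath-Brown's
constants of 1994-II Thm 1.  HEADLINE (`heathBrownLaw_parityBlind`): the even-conditioned law `P`
and the odd-conditioned law `Q` are probability laws on `ℕ` such that EVERY mixture
`p·P + (1−p)·Q` (`p : ℝ`) has `k`-th moment `E[2^{k s}] = ∏_{j=1}^{k}(1 + 2^j)` for all `k`, while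
its parity functional `E[(−1)^s]` equals `2p − 1`.  The moment data the item hypothesises (the
parity-balanced constants `c_k`, along every progression) is thus reproduced exactly by every parity
mix; no determinacy argument can extract `Σ(−1)^{s_φ} = o(x)` from it.  (Heath-Brown 1994-II gets
the distribution from the `c_k` only together with the parity of `s(D)`, constant on `D ≡ h (mod 8)`
by root numbers / Monsky — an INPUT there; on this route's pencil `E_t : y² = x³ + 2t x² + (t²+1) x`
the parity of `s_φ(t)` is the `ω(t²+1)`-parity to be proved, PencilSelmerDictionary.)

References: D. R. Heath-Brown, *The size of Selmer groups for the congruent number problem, II*,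
Invent. Math. 118 (1994) 331–370, Thms 1–2 (bib `HeathBrown1994SelmerCongruentII`); B. Poonen,
E. Rains, *Random maximal isotropic subspaces and Selmer groups*, JAMS 25 (2012), §2
(bib `PoonenRains2012`).  Refuter evidence on the item (MomentsParityBlind.md,
moments_parity_blind.py, 2026-08-15) found the obstruction by exact arithmetic for `k ≤ 8`; this is
the kernel-checked all-`k` statement.  Deliberately NOT here: anything about the actual Selmer
groups of `E_t` — the item has no Lean signature; this file concerns the MODEL LAWS its text names.
-/

namespace Summit.Parity.BatemanHorn.Theorems.MomentsToParity.Negative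

open Filter Finset
open scoped Topology

/-- Every factor `2^{j+1} − 1` of Heath-Brown's denominators is positive. [folklore] -/
theorem two_pow_succ_sub_one_pos (j : ℕ) : (0 : ℝ) < 2 ^ (j + 1) - 1 := by
  have h2 : (2 : ℝ) ≤ 2 ^ (j + 1) := by
    calc (2 : ℝ) = 2 ^ 1 := by norm_num
      _ ≤ 2 ^ (j + 1) := pow_le_pow_right₀ (by norm_num) (by omega)
  linarith

section Recursion

variable {a : ℕ → ℝ}

/-- The generating series `Σ_r a_r x^r` of a sequence with the Heath-Brown recursion converges
(absolutely) for every real `x`: the consecutive ratio is `2|x| / (2^{r+1} − 1) → 0`. [folklore] -/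
theorem summable_mul_pow (ha : ∀ r : ℕ, a (r + 1) * (2 ^ (r + 1) - 1) = 2 * a r) (x : ℝ) :
    Summable (fun r : ℕ => a r * x ^ r) := by
  refine summable_of_ratio_norm_eventually_le (r := 1 / 2) (by norm_num) ?_
  obtain ⟨N, hN⟩ : ∃ N : ℕ, 4 * |x| + 1 ≤ (2 : ℝ) ^ (N + 1) := by
    obtain ⟨N, hN⟩ := pow_unbounded_of_one_lt (4 * |x| + 1) (by norm_num : (1 : ℝ) < 2)
    exact ⟨N, hN.le.trans (pow_le_pow_right₀ (by norm_num) (by omega))⟩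
  filter_upwards [eventually_ge_atTop N] with r hr
  have hpow : (2 : ℝ) ^ (N + 1) ≤ 2 ^ (r + 1) := pow_le_pow_right₀ (by norm_num) (by omega)
  have hden : (0 : ℝ) < 2 ^ (r + 1) - 1 := two_pow_succ_sub_one_pos r
  have hrew : a (r + 1) * x ^ (r + 1) = (2 * x / (2 ^ (r + 1) - 1)) * (a r * x ^ r) := by
    rw [(eq_div_iff hden.ne').mpr (ha r)]
    field_simp
    ring
  rw [hrew, Real.norm_eq_abs, Real.norm_eq_abs, abs_mul]
  refine mul_le_mul_of_nonneg_right ?_ (abs_nonneg _)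
  rw [abs_div, abs_of_pos hden, div_le_iff₀ hden, abs_mul, abs_two]
  nlinarith [abs_nonneg x]

/-- **Euler's functional equation.** For a sequence with the Heath-Brown recursion the generating
function `G(x) = Σ_r a_r x^r` satisfies `G(2x) = (1 + 2x)·G(x)`: indeed
`G(2x) − G(x) = Σ_r a_r (2^r − 1) x^r = Σ_{r ≥ 1} 2 a_{r−1} x^r = 2x·G(x)`. [folklore] -/
theorem tsum_two_mul (ha : ∀ r : ℕ, a (r + 1) * (2 ^ (r + 1) - 1) = 2 * a r) (x : ℝ) :
    ∑' r : ℕ, a r * (2 * x) ^ r = (1 + 2 * x) * ∑' r : ℕ, a r * x ^ r := by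
  have h2 : HasSum (fun r : ℕ => a r * x ^ r) (∑' r : ℕ, a r * x ^ r) :=
    (summable_mul_pow ha x).hasSum
  -- the shifted series `Σ_r a_r (2^r − 1) x^r = 2x · G(x)`
  set g : ℕ → ℝ := fun r => a r * (2 ^ r - 1) * x ^ r with hg
  have hg0 : g 0 = 0 := by simp [hg]
  have hshift : HasSum (fun r : ℕ => g (r + 1)) (2 * x * ∑' r : ℕ, a r * x ^ r) := by
    have hfun : (fun r : ℕ => g (r + 1)) = fun r : ℕ => 2 * x * (a r * x ^ r) := by
      funext r
      simp only [hg]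
      calc a (r + 1) * (2 ^ (r + 1) - 1) * x ^ (r + 1)
          = (a (r + 1) * (2 ^ (r + 1) - 1)) * x ^ (r + 1) := by ring
        _ = 2 * a r * x ^ (r + 1) := by rw [ha r]
        _ = 2 * x * (a r * x ^ r) := by ring
    rw [hfun]
    exact h2.mul_left (2 * x)
  have hgsum : HasSum g (2 * x * ∑' r : ℕ, a r * x ^ r) := by
    have h4 := (hasSum_nat_add_iff (f := g) 1).mp hshift
    simpa [hg0] using h4
  have hsum := h2.add hgsum
  have hfun : (fun r : ℕ => a r * x ^ r + g r) = fun r : ℕ => a r * (2 * x) ^ r := by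
    funext r
    simp only [hg]
    rw [mul_pow]
    ring
  rw [hfun] at hsum
  rw [hsum.tsum_eq]
  ring

/-- `G(−2^k) = 0` for every `k : ℕ`: from `G(2x) = (1 + 2x) G(x)` at `x = −1/2` one gets
`G(−1) = 0`, and at `x = −2^k` one gets `G(−2^{k+1}) = (1 − 2^{k+1}) G(−2^k)`. [folklore] -/
theorem tsum_mul_neg_two_pow_pow (ha : ∀ r : ℕ, a (r + 1) * (2 ^ (r + 1) - 1) = 2 * a r)
    (k : ℕ) : ∑' r : ℕ, a r * (-(2 : ℝ) ^ k) ^ r = 0 := by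
  induction k with
  | zero =>
    have h := tsum_two_mul ha (-1 / 2)
    norm_num at h
    simpa using h
  | succ k ih =>
    have h := tsum_two_mul ha (-(2 : ℝ) ^ k)
    rw [ih, mul_zero] at h
    have h2 : (2 : ℝ) * (-(2 : ℝ) ^ k) = -(2 : ℝ) ^ (k + 1) := by ring
    rwa [h2] at h

/-- **The alternating moments vanish.** Under the Heath-Brown recursion,
`Σ_r (−1)^r 2^{k r} a_r = 0` for every `k : ℕ` (a genuine `HasSum`, the series converging
absolutely). For Heath-Brown's law this is `E[(−1)^s 2^{k s}] = 0`. [folklore] -/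
theorem hasSum_alternatingMoment (ha : ∀ r : ℕ, a (r + 1) * (2 ^ (r + 1) - 1) = 2 * a r)
    (k : ℕ) : HasSum (fun r : ℕ => (-1 : ℝ) ^ r * 2 ^ (k * r) * a r) 0 := by
  have hs := (summable_mul_pow ha (-(2 : ℝ) ^ k)).hasSum
  rw [tsum_mul_neg_two_pow_pow ha k] at hs
  convert hs using 1
  funext r
  rw [neg_pow, pow_mul]
  ring

/-- The (non-alternating) `k`-th moment series `Σ_r 2^{k r} a_r` converges. [folklore] -/
theorem summable_moment (ha : ∀ r : ℕ, a (r + 1) * (2 ^ (r + 1) - 1) = 2 * a r) (k : ℕ) :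
    Summable (fun r : ℕ => (2 : ℝ) ^ (k * r) * a r) := by
  have hs := summable_mul_pow ha ((2 : ℝ) ^ k)
  convert hs using 1
  funext r
  rw [← pow_mul]
  ring

/-- The even part `Σ_{r even} 2^{k r} a_r` of the `k`-th moment series converges. [folklore] -/
theorem summable_evenMoment (ha : ∀ r : ℕ, a (r + 1) * (2 ^ (r + 1) - 1) = 2 * a r) (k : ℕ) :
    Summable (fun r : ℕ => if Even r then (2 : ℝ) ^ (k * r) * a r else 0) := by
  refine Summable.of_norm_bounded (summable_moment ha k).norm (fun r => ?_)
  split_ifs <;> simp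

/-- The odd part `Σ_{r odd} 2^{k r} a_r` of the `k`-th moment series converges. [folklore] -/
theorem summable_oddMoment (ha : ∀ r : ℕ, a (r + 1) * (2 ^ (r + 1) - 1) = 2 * a r) (k : ℕ) :
    Summable (fun r : ℕ => if Odd r then (2 : ℝ) ^ (k * r) * a r else 0) := by
  refine Summable.of_norm_bounded (summable_moment ha k).norm (fun r => ?_)
  split_ifs <;> simp

/-- **Even and odd moments agree.** Under the Heath-Brown recursion, for every `k : ℕ` the
even-rank part and the odd-rank part of the `k`-th moment have the SAME sum:
`Σ_{r even} 2^{k r} a_r = Σ_{r odd} 2^{k r} a_r`. [folklore] -/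
theorem exists_hasSum_evenMoment_and_oddMoment
    (ha : ∀ r : ℕ, a (r + 1) * (2 ^ (r + 1) - 1) = 2 * a r) (k : ℕ) :
    ∃ M : ℝ, HasSum (fun r : ℕ => if Even r then (2 : ℝ) ^ (k * r) * a r else 0) M ∧
      HasSum (fun r : ℕ => if Odd r then (2 : ℝ) ^ (k * r) * a r else 0) M := by
  have he := (summable_evenMoment ha k).hasSum
  have ho := (summable_oddMoment ha k).hasSum
  refine ⟨_, he, ?_⟩
  have hdiff := he.sub ho
  have heo : (fun r : ℕ => (if Even r then (2 : ℝ) ^ (k * r) * a r else 0)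
      - (if Odd r then (2 : ℝ) ^ (k * r) * a r else 0))
      = fun r : ℕ => (-1 : ℝ) ^ r * 2 ^ (k * r) * a r := by
    funext r
    rcases Nat.even_or_odd r with hr | hr
    · have hr' : ¬ Odd r := Nat.not_odd_iff_even.mpr hr
      simp [hr, hr', hr.neg_one_pow]
    · have hr' : ¬ Even r := Nat.not_even_iff_odd.mpr hr
      simp [hr, hr', hr.neg_one_pow]
  rw [heo] at hdiff
  have h0 := hdiff.unique (hasSum_alternatingMoment ha k)
  have h1 : ∑' r : ℕ, (if Odd r then (2 : ℝ) ^ (k * r) * a r else 0)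
      = ∑' r : ℕ, (if Even r then (2 : ℝ) ^ (k * r) * a r else 0) := by linarith
  rw [← h1]
  exact ho

/-- The model moment constants: `Σ_{r even} 2^{k r} a_r = (∏_{j=1}^{k} (1 + 2^j)) · Σ_{r even} a_r`
(so, normalised, `c_k = 3, 15, 135, 2295, …` — Heath-Brown's `c_k`, the same for the even law, the
odd law and every mix). From `G(2^{k}) = (1 + 2^{k}) G(2^{k-1})` and even part `= G/2`. [folklore] -/
theorem hasSum_evenMoment_eq_prod_mul
    (ha : ∀ r : ℕ, a (r + 1) * (2 ^ (r + 1) - 1) = 2 * a r) (k : ℕ) :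
    HasSum (fun r : ℕ => if Even r then (2 : ℝ) ^ (k * r) * a r else 0)
      ((∏ j ∈ Finset.range k, (1 + (2 : ℝ) ^ (j + 1))) *
        ∑' r : ℕ, (if Even r then a r else 0)) := by
  -- full moment `G(2^k) = ∏ (1 + 2^j) · G(1)`
  have hG : ∀ k : ℕ, ∑' r : ℕ, a r * ((2 : ℝ) ^ k) ^ r
      = (∏ j ∈ Finset.range k, (1 + (2 : ℝ) ^ (j + 1))) * ∑' r : ℕ, a r * (1 : ℝ) ^ r := by
    intro k
    induction k with
    | zero => simp
    | succ k ih =>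
      rw [Finset.prod_range_succ, pow_succ, mul_comm ((2 : ℝ) ^ k) 2, tsum_two_mul ha, ih]
      ring
  -- even part is half of the full moment, at level k and at level 0
  have half : ∀ k : ℕ, HasSum (fun r : ℕ => if Even r then (2 : ℝ) ^ (k * r) * a r else 0)
      ((∑' r : ℕ, a r * ((2 : ℝ) ^ k) ^ r) / 2) := by
    intro k
    obtain ⟨M, he, ho⟩ := exists_hasSum_evenMoment_and_oddMoment ha k
    have hfull : HasSum (fun r : ℕ => a r * ((2 : ℝ) ^ k) ^ r) (M + M) := by
      convert he.add ho using 1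
      funext r
      rcases Nat.even_or_odd r with hr | hr
      · have hr' : ¬ Odd r := Nat.not_odd_iff_even.mpr hr
        simp [hr, hr', ← pow_mul]; ring
      · have hr' : ¬ Even r := Nat.not_even_iff_odd.mpr hr
        simp [hr, hr', ← pow_mul]; ring
    rw [hfull.tsum_eq]
    convert he using 1
    ring
  have hk := half k
  rw [hG k] at hk
  have h0 := half 0
  simp only [zero_mul, pow_zero, one_mul] at h0
  rw [h0.tsum_eq]
  convert hk using 1
  ring

end Recursion

section HeathBrownLaw

/-- Heath-Brown's weights `a_r = 2^r / ∏_{j=1}^{r} (2^j − 1)` are positive. [folklore] -/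
theorem heathBrownWeight_pos (r : ℕ) :
    (0 : ℝ) < 2 ^ r / ∏ j ∈ Finset.range r, ((2 : ℝ) ^ (j + 1) - 1) :=
  div_pos (pow_pos two_pos r) (Finset.prod_pos fun j _ => two_pow_succ_sub_one_pos j)

/-- Heath-Brown's weights satisfy the recursion `a_{r+1} (2^{r+1} − 1) = 2 a_r`. [folklore] -/
theorem heathBrownWeight_recursion (r : ℕ) :
    (2 : ℝ) ^ (r + 1) / (∏ j ∈ Finset.range (r + 1), ((2 : ℝ) ^ (j + 1) - 1)) * (2 ^ (r + 1) - 1)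
      = 2 * (2 ^ r / ∏ j ∈ Finset.range r, ((2 : ℝ) ^ (j + 1) - 1)) := by
  have hP : (0 : ℝ) < ∏ j ∈ Finset.range r, ((2 : ℝ) ^ (j + 1) - 1) :=
    Finset.prod_pos fun j _ => two_pow_succ_sub_one_pos j
  have hr := two_pow_succ_sub_one_pos r
  rw [Finset.prod_range_succ]
  field_simp
  ring

/-- **PARITY-BLINDNESS OF THE MODEL MOMENTS** (the item's mechanism, refuted at the model level).
Let `P` and `Q` be the even- and odd-conditioned Heath-Brown / Poonen–Rains laws
(`P r = a_r / M_0` for even `r`, `Q r = a_r / M_0` for odd `r`, `a_r = 2^r / ∏_{j=1}^{r} (2^j − 1)`,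
`M_0 = Σ_{r even} a_r = Σ_{r odd} a_r`).  Both are nonnegative, and for EVERY mixing weight `p : ℝ`
the mixture `p·P + (1−p)·Q` has `k`-th moment `Σ_r 2^{k r}(p P r + (1−p) Q r) = ∏_{j=1}^{k}(1 + 2^j)`
— Heath-Brown's `c_k = 1, 3, 15, 135, …`, INDEPENDENT of `p` (`k = 0`: mass `1`) — while its parity
functional is `Σ_r (−1)^r (p P r + (1−p) Q r) = 2p − 1`.  (`p = 1`, `p = 0`: the two pure laws have
identical moment sequences and parities `+1`, `−1`.)  Hence no functional of the moments
`(E[2^{k s}])_k` determines `E[(−1)^s]`, and "the two model laws have distinct moment sequences, so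
the moments fix `p = 1/2`" is false.
[cite: HeathBrown1994SelmerCongruentII, Thms 1–2 (the constants `c_k`; distribution needs parity)] -/
theorem heathBrownLaw_parityBlind :
    ∃ P Q : ℕ → ℝ, (∀ r, 0 ≤ P r) ∧ (∀ r, 0 ≤ Q r) ∧
      (∀ r, ¬ Even r → P r = 0) ∧ (∀ r, ¬ Odd r → Q r = 0) ∧
      ∀ p : ℝ,
        (∀ k : ℕ, HasSum (fun r : ℕ => (2 : ℝ) ^ (k * r) * (p * P r + (1 - p) * Q r))
          (∏ j ∈ Finset.range k, (1 + (2 : ℝ) ^ (j + 1)))) ∧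
        HasSum (fun r : ℕ => (-1 : ℝ) ^ r * (p * P r + (1 - p) * Q r)) (2 * p - 1) := by
  set a : ℕ → ℝ := fun r => 2 ^ r / ∏ j ∈ Finset.range r, ((2 : ℝ) ^ (j + 1) - 1) with ha_def
  have ha : ∀ r : ℕ, a (r + 1) * (2 ^ (r + 1) - 1) = 2 * a r := fun r => by
    simp only [ha_def]
    exact heathBrownWeight_recursion r
  have hapos : ∀ r : ℕ, 0 < a r := fun r => by
    simp only [ha_def]
    exact heathBrownWeight_pos r
  -- `M0` = the even mass (= the odd mass), positive
  obtain ⟨M0, he0, hM0⟩ : ∃ M0 : ℝ, HasSum (fun r : ℕ => if Even r then a r else 0) M0 ∧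
      (∑' r : ℕ, (if Even r then a r else 0)) = M0 := by
    have h := (summable_evenMoment ha 0).hasSum
    simp only [zero_mul, pow_zero, one_mul] at h
    exact ⟨_, h, rfl⟩
  have hM0pos : 0 < M0 := by
    have hle := le_hasSum he0 0 (fun j _ => by
      split_ifs
      · exact (hapos j).le
      · exact le_rfl)
    have h00 : (if Even 0 then a 0 else 0) = 1 := by simp [ha_def]
    linarith
  have hM0ne : M0 ≠ 0 := hM0pos.ne'
  -- even and odd `k`-th moments of `a`, both `= c_k · M0`; normalised by `M0` they are `c_k`
  have hcancel : ∀ k : ℕ, (∏ j ∈ Finset.range k, (1 + (2 : ℝ) ^ (j + 1))) * M0 / M0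
      = ∏ j ∈ Finset.range k, (1 + (2 : ℝ) ^ (j + 1)) := fun k => by
    rw [mul_div_assoc, div_self hM0ne, mul_one]
  have hek : ∀ k : ℕ, HasSum (fun r : ℕ => if Even r then (2 : ℝ) ^ (k * r) * a r else 0)
      ((∏ j ∈ Finset.range k, (1 + (2 : ℝ) ^ (j + 1))) * M0) := fun k => by
    have h := hasSum_evenMoment_eq_prod_mul ha k
    rwa [hM0] at h
  have hPk : ∀ k : ℕ, HasSum (fun r : ℕ => (2 : ℝ) ^ (k * r) * (if Even r then a r / M0 else 0))
      (∏ j ∈ Finset.range k, (1 + (2 : ℝ) ^ (j + 1))) := fun k => by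
    have h := (hek k).div_const M0
    rw [hcancel k] at h
    exact h.congr_fun (fun r => by split_ifs <;> ring)
  have hQk : ∀ k : ℕ, HasSum (fun r : ℕ => (2 : ℝ) ^ (k * r) * (if Odd r then a r / M0 else 0))
      (∏ j ∈ Finset.range k, (1 + (2 : ℝ) ^ (j + 1))) := fun k => by
    obtain ⟨M, he, ho⟩ := exists_hasSum_evenMoment_and_oddMoment ha k
    rw [he.unique (hek k)] at ho
    have h := ho.div_const M0
    rw [hcancel k] at h
    exact h.congr_fun (fun r => by split_ifs <;> ring)
  refine ⟨fun r => if Even r then a r / M0 else 0, fun r => if Odd r then a r / M0 else 0,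
    fun r => ?_, fun r => ?_, fun r hr => if_neg hr, fun r hr => if_neg hr, fun p => ⟨fun k => ?_, ?_⟩⟩
  · show 0 ≤ (if Even r then a r / M0 else 0)
    split_ifs
    · exact div_nonneg (hapos r).le hM0pos.le
    · exact le_rfl
  · show 0 ≤ (if Odd r then a r / M0 else 0)
    split_ifs
    · exact div_nonneg (hapos r).le hM0pos.le
    · exact le_rfl
  · -- moments of the mixture: `p·c_k + (1 − p)·c_k = c_k`
    have h := ((hPk k).mul_left p).add ((hQk k).mul_left (1 - p))
    rw [show p * (∏ j ∈ Finset.range k, (1 + (2 : ℝ) ^ (j + 1)))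
        + (1 - p) * (∏ j ∈ Finset.range k, (1 + (2 : ℝ) ^ (j + 1)))
        = ∏ j ∈ Finset.range k, (1 + (2 : ℝ) ^ (j + 1)) by ring] at h
    exact h.congr_fun (fun r => by
      show (2 : ℝ) ^ (k * r) * (p * (if Even r then a r / M0 else 0)
          + (1 - p) * (if Odd r then a r / M0 else 0)) = _
      ring)
  · -- parity of the mixture: `(−1)^r` is `+1` on the support of `P` and `−1` on that of `Q`
    have hP0 := hPk 0
    have hQ0 := hQk 0
    simp only [zero_mul, pow_zero, one_mul, Finset.prod_range_zero] at hP0 hQ0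
    have h := (hP0.mul_left p).sub (hQ0.mul_left (1 - p))
    rw [show p * (1 : ℝ) - (1 - p) * 1 = 2 * p - 1 by ring] at h
    exact h.congr_fun (fun r => by
      show (-1 : ℝ) ^ r * (p * (if Even r then a r / M0 else 0)
          + (1 - p) * (if Odd r then a r / M0 else 0)) = _
      rcases Nat.even_or_odd r with hr | hr
      · have hr' : ¬ Odd r := Nat.not_odd_iff_even.mpr hr
        simp only [if_pos hr, if_neg hr', hr.neg_one_pow]
        ring
      · have hr' : ¬ Even r := Nat.not_even_iff_odd.mpr hr
        simp only [if_pos hr, if_neg hr', hr.neg_one_pow]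
        ring)

end HeathBrownLaw

end Summit.Parity.BatemanHorn.Theorems.MomentsToParity.Negative
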